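import Summits.QuantumFields.BalabanUV.T4Continuum.Support.NE3Linearising

/-!
# T⁴ programme, node NE3, route P2 «ENERGY CONVEXITY» — leaf L2 (PATH), abstract layer, part 2: THE KINEMATICS OF B11's
# ANALYTIC CHART SEGMENT — real-`C²` regularity and the CAUCHY BOUNDS on its velocity and acceleration

NE3 formalisation swarm `b2b-balaban-t4-ne3-formalise-*` of the cell `pub-balaban`, unit
`b2b-balaban-t4-ne3-formalise-leaf-03` (gen 4), sub-row **S5-Y2b-abs** of `t4/formal/NE3/LEAVES.md` (leaf-proposed, journal
INTENT 2026-08-20T10:16Z).  Road P2's skeleton `t4/skeletons/NE3-t4-ne3-p2.md` v1.5 §2A L2 names this step verbatim: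
«the ONE-PARAMETER path `t ↦ Φ_W(tX₀)` is real-analytic, hence `C²` with Cauchy bounds on `Γ′`, `Γ″` — exactly fields
`d1`∕`d2`∕`velocity`» and «(Cauchy bounds on `Γ′`, `Γ″` are the typer's next step, tree
`B13Contraction113.norm_sub_le_of_sphere_bound`)».  INPUT (tree, BY NAME): `NE3Linearising.exists_linearising_path`
(E3, p207705) delivers, over abstract complex Banach spaces `𝒳` (coarse data) and `𝒴` (directions), a map
`Xs : ℂ → 𝒳` HOLOMORPHIC on `ball 0 ρ` with `‖Xs σ‖ ≤ 4C₂‖σ • X₀‖²` and `N (σ • X₀ − Hop (Xs σ)) = σ • Q X₀`, `Hop` a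
`b`-bounded `ℂ`-linear right inverse of the linearised constraint.  THIS FILE ([folklore] complex analysis, 0 `def`,
0 sorry) turns that into the kinematic data of the real chart path
  `Γ t := (t : ℂ) • X₀ − Hop (Xs t)`,  `t ∈ [0, 1]` (inside the disc when `1 + r < ρ`):

* §1 GENERIC CAUCHY BOUNDS at a point `c` with `closedBall c r` inside the holomorphy set: `‖deriv h c‖ ≤ M ∕ r`
  (`Complex.norm_deriv_le_of_forall_mem_sphere_norm_le`) and `‖deriv (deriv h) c‖ ≤ 2M ∕ r²`
  (`Complex.norm_iteratedDeriv_le_of_forall_mem_sphere_norm_le` with `n = 2`); the REAL RESTRICTIONS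
  `HasDerivAt (h ∘ ofReal) (deriv h t) t` and `HasDerivAt (deriv h ∘ ofReal) (deriv (deriv h) t) t`
  (`B13Contraction113.hasDerivAt_comp_ofReal` + analyticity of the derivative);
* §2 THE CHART PATH: `Γ 0 = 0`; `‖Γ t − t • X₀‖ ≤ 4bC₂·t²·‖X₀‖²`; for every real `t` with `|t| ≤ 1`:
  `HasDerivAt Γ (X₀ − Hop (deriv Xs t)) t`, `HasDerivAt (t ↦ X₀ − Hop (deriv Xs t)) (−Hop (deriv (deriv Xs) t)) t`, and
  the DISPLAYED bounds **`‖Γ′ t − X₀‖ ≤ b·(4C₂ρ²‖X₀‖²) ∕ r`**, **`‖Γ″ t‖ ≤ b·2·(4C₂ρ²‖X₀‖²) ∕ r²`** — i.e. velocity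
  `θ`-close to `X₀` and acceleration `κ_Φ`-small with `θ = 4bC₂ρ²‖X₀‖ ∕ r`, `κ_Φ·‖X₀‖² = 8bC₂ρ²‖X₀‖² ∕ r²`, both
  `O(bC₂‖X₀‖)` relative to `‖X₀‖` (the chart-norm half of `RouteLeaves.velocity` ∕ `close` ∕ `curv`);
* §3 THE REVERSED ORIENTATION `t ↦ Γ(1 − t)` of `NE3EnergyAssembly.RouteLeaves` (`endW : Γ_R 1 = 0`, derivatives with the
  sign flipped once), and the one-structure package `chartPath_kinematics`.

WHAT IS NOT HERE (located inputs of L2, other seats): (L2-i) a `k`-uniformly bounded right inverse `Hop` of Bałaban's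
linearised `k`-fold average (crew sub-row S6-Y7c); (L2-ii) the `k`-uniform quadratic constant `C₂` (S6-Y7 (a)); the
ENERGY-norm dress of the bounds (the norm of `𝒴` here is abstract; the torus instantiation chooses it) and the right-log
velocity correction (`NE3EnergyPathC2Velocity.norm_rvel_sub_le`).

HONEST FRAMING.  Finite-T⁴ bookkeeping (rung (B)+1); complex analysis of one holomorphic curve in a Banach space; NOTHING
about Bałaban's minimisers, his `H`, `C_k`, or any lattice is asserted; no conditional of the cell (`BetaPertH`, (B),
G-an2-4) is used or hidden; NOT infinite volume ∕ mass gap ∕ Clay ∕ summit progress; **NE3 is NOT proved**; NE3-E stays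
CONDITIONAL on ⟨named structures⟩; spine PROVED 0∕9.  ABSOLUTE RULE kept: no printed sentence is a hypothesis of a
theorem (context only: [Balaban1985Variational] (47)–(58) pp. 285–287, Prop. 3 p. 289).  HONEST DEPENDENCY: continuum YM
on T⁴ ⇐ BetaPertH ∧ nine spine estimates (0/9 proved); BetaPertH ⇐ (D1) ∧ (D4) ∧ CAP+tail; G-an2-4 gates asym, D1 and
NE2/3/4.  PLACEMENT: `Summits/QuantumFields/BalabanUV/`; imports the accepted `Support.NE3Linearising` only.
-/

set_option autoImplicit false

open Metric Set

namespace Summit.QuantumFields.BalabanUV.T4Continuum.NE3LinearisingPath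

open Literature.MathematicalPhysics.QuantumFieldTheory.Balaban1983to89.B13Contraction113 (hasDerivAt_comp_ofReal QuadAnalytic)
open NE3Linearising (exists_linearising_path)

noncomputable section

/-! ## §1 Generic Cauchy bounds and real restrictions of a holomorphic Banach-valued map -/

section Cauchy

variable {E : Type*} [NormedAddCommGroup E] [NormedSpace ℂ E]

/-- **CAUCHY'S ESTIMATE, first derivative, «margin» form**: if `h` is complex-differentiable on an open `U` containing
`closedBall c r` (`r > 0`) and `‖h‖ ≤ M` on that closed ball, then `‖deriv h c‖ ≤ M ∕ r`. [folklore] -/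
theorem norm_deriv_le_of_closedBall {h : ℂ → E} {U : Set ℂ} (hd : DifferentiableOn ℂ h U) {c : ℂ} {r M : ℝ}
    (hr : 0 < r) (hsub : closedBall c r ⊆ U) (hM : ∀ z ∈ closedBall c r, ‖h z‖ ≤ M) : ‖deriv h c‖ ≤ M / r :=
  Complex.norm_deriv_le_of_forall_mem_sphere_norm_le hr (hd.diffContOnCl_ball hsub)
    fun z hz => hM z (sphere_subset_closedBall hz)

/-- **CAUCHY'S ESTIMATE, second derivative, «margin» form** (complete codomain): under the same hypotheses
`‖deriv (deriv h) c‖ ≤ 2M ∕ r²`. [folklore] -/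
theorem norm_deriv_deriv_le_of_closedBall [CompleteSpace E] {h : ℂ → E} {U : Set ℂ} (hd : DifferentiableOn ℂ h U)
    {c : ℂ} {r M : ℝ} (hr : 0 < r) (hsub : closedBall c r ⊆ U) (hM : ∀ z ∈ closedBall c r, ‖h z‖ ≤ M) :
    ‖deriv (deriv h) c‖ ≤ 2 * M / r ^ 2 := by
  have h2 := Complex.norm_iteratedDeriv_le_of_forall_mem_sphere_norm_le 2 hr (hd.diffContOnCl_ball hsub)
    fun z hz => hM z (sphere_subset_closedBall hz)
  rw [iteratedDeriv_succ, iteratedDeriv_one] at h2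
  simpa [Nat.factorial] using h2

/-- The derivative of a map complex-differentiable on an OPEN set is complex-differentiable there (complete codomain).
[folklore] -/
theorem differentiableOn_deriv [CompleteSpace E] {h : ℂ → E} {U : Set ℂ} (hU : IsOpen U)
    (hd : DifferentiableOn ℂ h U) : DifferentiableOn ℂ (deriv h) U :=
  ((hd.analyticOnNhd hU).deriv_of_isOpen hU).differentiableOn

/-- **REAL RESTRICTION, first derivative**: at a real point of an open holomorphy set, `t ↦ h t` (`t : ℝ`) has derivative
`deriv h t`. [folklore] -/
theorem hasDerivAt_ofReal {h : ℂ → E} {U : Set ℂ} (hU : IsOpen U) (hd : DifferentiableOn ℂ h U) {t : ℝ}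
    (ht : (t : ℂ) ∈ U) : HasDerivAt (fun s : ℝ => h (s : ℂ)) (deriv h (t : ℂ)) t :=
  hasDerivAt_comp_ofReal (hd.differentiableAt (hU.mem_nhds ht)).hasDerivAt

/-- **REAL RESTRICTION, second derivative** (complete codomain): `t ↦ deriv h t` (`t : ℝ`) has derivative
`deriv (deriv h) t` at a real point of the open holomorphy set. [folklore] -/
theorem hasDerivAt_deriv_ofReal [CompleteSpace E] {h : ℂ → E} {U : Set ℂ} (hU : IsOpen U)
    (hd : DifferentiableOn ℂ h U) {t : ℝ} (ht : (t : ℂ) ∈ U) :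
    HasDerivAt (fun s : ℝ => deriv h (s : ℂ)) (deriv (deriv h) (t : ℂ)) t :=
  hasDerivAt_ofReal hU (differentiableOn_deriv hU hd) ht

/-- The real restriction of a map holomorphic on an open set is `C^n` (every `n`) on the real trace of that set
(complete codomain). [folklore] -/
theorem contDiffOn_ofReal [CompleteSpace E] {h : ℂ → E} {U : Set ℂ} (hU : IsOpen U) (hd : DifferentiableOn ℂ h U)
    (n : WithTop ℕ∞) : ContDiffOn ℝ n (fun s : ℝ => h (s : ℂ)) {s : ℝ | (s : ℂ) ∈ U} := by
  have hA : ContDiffOn ℂ n h U := (hd.analyticOnNhd hU).contDiffOn_of_completeSpace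
  have hA' : ContDiffOn ℝ n h U := hA.restrict_scalars ℝ
  exact hA'.comp Complex.ofRealCLM.contDiff.contDiffOn fun s hs => hs

end Cauchy

/-! ## §2 The chart path `Γ t = t • X₀ − Hop (Xs t)` -/

section ChartPath

variable {𝒳 𝒴 : Type*} [NormedAddCommGroup 𝒳] [NormedSpace ℂ 𝒳] [NormedAddCommGroup 𝒴] [NormedSpace ℂ 𝒴]

/-- A real point `t` with `|t| ≤ 1` has its closed `r`-disc inside `ball 0 ρ` once `1 + r < ρ`. [folklore] -/
theorem closedBall_ofReal_subset_ball {t r ρ : ℝ} (ht : |t| ≤ 1) (hρ : 1 + r < ρ) :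
    closedBall (t : ℂ) r ⊆ ball (0 : ℂ) ρ := by
  refine closedBall_subset_ball' ?_
  rw [dist_zero_right, Complex.norm_real, Real.norm_eq_abs]
  linarith

omit [NormedSpace ℂ 𝒳] in
/-- The quadratic bound of E3 read on the whole disc: `‖Xs σ‖ ≤ 4C₂ρ²‖X₀‖²` for `σ ∈ ball 0 ρ`. [folklore] -/
theorem norm_le_of_quadBound {Xs : ℂ → 𝒳} {X₀ : 𝒴} {C₂ ρ : ℝ} (hC₂ : 0 ≤ C₂)
    (hXs : ∀ σ ∈ ball (0 : ℂ) ρ, ‖Xs σ‖ ≤ 4 * C₂ * ‖σ • X₀‖ ^ 2) {σ : ℂ} (hσ : σ ∈ ball (0 : ℂ) ρ) :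
    ‖Xs σ‖ ≤ 4 * C₂ * ρ ^ 2 * ‖X₀‖ ^ 2 := by
  have hσ' : ‖σ‖ < ρ := by simpa using hσ
  have hρ : 0 ≤ ρ := (norm_nonneg σ).trans hσ'.le
  calc ‖Xs σ‖ ≤ 4 * C₂ * ‖σ • X₀‖ ^ 2 := hXs σ hσ
    _ = 4 * C₂ * (‖σ‖ ^ 2 * ‖X₀‖ ^ 2) := by rw [norm_smul, mul_pow]
    _ ≤ 4 * C₂ * (ρ ^ 2 * ‖X₀‖ ^ 2) := by
        gcongr
    _ = 4 * C₂ * ρ ^ 2 * ‖X₀‖ ^ 2 := by ring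

/-- **THE CHART ORIGIN**: `Xs 0 = 0` (the quadratic bound at `σ = 0`), hence `Γ 0 = 0`. [folklore] -/
theorem chartPath_zero {Xs : ℂ → 𝒳} {X₀ : 𝒴} {C₂ ρ : ℝ} (hρ : 0 < ρ) (Hop : 𝒳 →ₗ[ℂ] 𝒴)
    (hXs : ∀ σ ∈ ball (0 : ℂ) ρ, ‖Xs σ‖ ≤ 4 * C₂ * ‖σ • X₀‖ ^ 2) :
    ((0 : ℝ) : ℂ) • X₀ - Hop (Xs ((0 : ℝ) : ℂ)) = 0 := by
  have h0 : Xs 0 = 0 := by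
    have h := hXs 0 (mem_ball_self hρ)
    rw [zero_smul, norm_zero, zero_pow two_ne_zero, mul_zero] at h
    exact norm_le_zero_iff.mp h
  simp [h0]

/-- **THE PATH IS QUADRATICALLY CLOSE TO THE STRAIGHT SEGMENT**: `‖Γ t − t • X₀‖ ≤ b·4C₂·t²·‖X₀‖²` for `|t| < ρ`.
[folklore] -/
theorem norm_chartPath_sub_smul_le {Xs : ℂ → 𝒳} {X₀ : 𝒴} {C₂ ρ b : ℝ} {Hop : 𝒳 →ₗ[ℂ] 𝒴}
    (hHop : ∀ X, ‖Hop X‖ ≤ b * ‖X‖) (hb : 0 ≤ b)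
    (hXs : ∀ σ ∈ ball (0 : ℂ) ρ, ‖Xs σ‖ ≤ 4 * C₂ * ‖σ • X₀‖ ^ 2) {t : ℝ} (ht : |t| < ρ) :
    ‖((t : ℂ) • X₀ - Hop (Xs (t : ℂ))) - (t : ℂ) • X₀‖ ≤ b * (4 * C₂ * t ^ 2 * ‖X₀‖ ^ 2) := by
  have hmem : (t : ℂ) ∈ ball (0 : ℂ) ρ := by
    rw [mem_ball_zero_iff, Complex.norm_real, Real.norm_eq_abs]; exact ht
  have h := hXs _ hmem
  rw [norm_smul, Complex.norm_real, Real.norm_eq_abs, mul_pow, sq_abs] at h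
  rw [sub_sub_cancel_left, norm_neg]
  calc ‖Hop (Xs (t : ℂ))‖ ≤ b * ‖Xs (t : ℂ)‖ := hHop _
    _ ≤ b * (4 * C₂ * (t ^ 2 * ‖X₀‖ ^ 2)) := mul_le_mul_of_nonneg_left h hb
    _ = b * (4 * C₂ * t ^ 2 * ‖X₀‖ ^ 2) := by ring

/-- **THE PATH IS REAL-DIFFERENTIABLE** with velocity `Γ′ t = X₀ − Hop (deriv Xs t)` at every real `t` with `|t| ≤ 1`
(`1 + r < ρ`, `r > 0`). [folklore] -/
theorem hasDerivAt_chartPath {Xs : ℂ → 𝒳} {ρ r b : ℝ} (hXd : DifferentiableOn ℂ Xs (ball (0 : ℂ) ρ))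
    {Hop : 𝒳 →ₗ[ℂ] 𝒴} (hHop : ∀ X, ‖Hop X‖ ≤ b * ‖X‖) (X₀ : 𝒴) (hr : 0 < r) (hρ : 1 + r < ρ)
    {t : ℝ} (ht : |t| ≤ 1) :
    HasDerivAt (fun s : ℝ => (s : ℂ) • X₀ - Hop (Xs (s : ℂ))) (X₀ - Hop (deriv Xs (t : ℂ))) t := by
  have hmem : (t : ℂ) ∈ ball (0 : ℂ) ρ := closedBall_ofReal_subset_ball ht hρ (mem_closedBall_self hr.le)
  -- the straight part
  have h1 : HasDerivAt (fun s : ℝ => (s : ℂ) • X₀) X₀ t := by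
    have h := hasDerivAt_comp_ofReal (((hasDerivAt_id (t : ℂ)).smul_const X₀))
    simpa using h
  -- the correction through the bounded linear `Hop`
  have h2 : HasDerivAt (fun s : ℝ => Xs (s : ℂ)) (deriv Xs (t : ℂ)) t := hasDerivAt_ofReal isOpen_ball hXd hmem
  have h3 : HasDerivAt (fun s : ℝ => Hop (Xs (s : ℂ))) (Hop (deriv Xs (t : ℂ))) t := by
    have h := ((Hop.mkContinuous b hHop).restrictScalars ℝ).hasFDerivAt.comp_hasDerivAt t h2
    simpa [Function.comp_def] using h
  exact h1.sub h3

/-- **THE VELOCITY IS REAL-DIFFERENTIABLE** with acceleration `Γ″ t = −Hop (deriv (deriv Xs) t)` at every real `t` with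
`|t| ≤ 1` (complete `𝒳`). [folklore] -/
theorem hasDerivAt_chartPath_deriv [CompleteSpace 𝒳] {Xs : ℂ → 𝒳} {ρ r b : ℝ}
    (hXd : DifferentiableOn ℂ Xs (ball (0 : ℂ) ρ)) {Hop : 𝒳 →ₗ[ℂ] 𝒴} (hHop : ∀ X, ‖Hop X‖ ≤ b * ‖X‖) (X₀ : 𝒴)
    (hr : 0 < r) (hρ : 1 + r < ρ) {t : ℝ} (ht : |t| ≤ 1) :
    HasDerivAt (fun s : ℝ => X₀ - Hop (deriv Xs (s : ℂ))) (-Hop (deriv (deriv Xs) (t : ℂ))) t := by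
  have hmem : (t : ℂ) ∈ ball (0 : ℂ) ρ := closedBall_ofReal_subset_ball ht hρ (mem_closedBall_self hr.le)
  have h2 : HasDerivAt (fun s : ℝ => deriv Xs (s : ℂ)) (deriv (deriv Xs) (t : ℂ)) t :=
    hasDerivAt_deriv_ofReal isOpen_ball hXd hmem
  have h3 : HasDerivAt (fun s : ℝ => Hop (deriv Xs (s : ℂ))) (Hop (deriv (deriv Xs) (t : ℂ))) t := by
    have h := ((Hop.mkContinuous b hHop).restrictScalars ℝ).hasFDerivAt.comp_hasDerivAt t h2
    simpa [Function.comp_def] using h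
  simpa using h3.const_sub X₀

/-- **CAUCHY BOUND ON THE VELOCITY DEFECT**: `‖Γ′ t − X₀‖ ≤ b·(4C₂ρ²‖X₀‖²) ∕ r` for `|t| ≤ 1`. [folklore] -/
theorem norm_chartPath_deriv_sub_le {Xs : ℂ → 𝒳} {X₀ : 𝒴} {C₂ ρ r b : ℝ} (hC₂ : 0 ≤ C₂) (hb : 0 ≤ b)
    (hXd : DifferentiableOn ℂ Xs (ball (0 : ℂ) ρ))
    (hXs : ∀ σ ∈ ball (0 : ℂ) ρ, ‖Xs σ‖ ≤ 4 * C₂ * ‖σ • X₀‖ ^ 2)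
    {Hop : 𝒳 →ₗ[ℂ] 𝒴} (hHop : ∀ X, ‖Hop X‖ ≤ b * ‖X‖) (hr : 0 < r) (hρ : 1 + r < ρ) {t : ℝ} (ht : |t| ≤ 1) :
    ‖(X₀ - Hop (deriv Xs (t : ℂ))) - X₀‖ ≤ b * (4 * C₂ * ρ ^ 2 * ‖X₀‖ ^ 2) / r := by
  have hsub : closedBall (t : ℂ) r ⊆ ball (0 : ℂ) ρ := closedBall_ofReal_subset_ball ht hρ
  have hM : ∀ z ∈ closedBall (t : ℂ) r, ‖Xs z‖ ≤ 4 * C₂ * ρ ^ 2 * ‖X₀‖ ^ 2 :=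
    fun z hz => norm_le_of_quadBound hC₂ hXs (hsub hz)
  have hd := norm_deriv_le_of_closedBall hXd hr hsub hM
  rw [sub_sub_cancel_left, norm_neg]
  calc ‖Hop (deriv Xs (t : ℂ))‖ ≤ b * ‖deriv Xs (t : ℂ)‖ := hHop _
    _ ≤ b * (4 * C₂ * ρ ^ 2 * ‖X₀‖ ^ 2 / r) := mul_le_mul_of_nonneg_left hd hb
    _ = b * (4 * C₂ * ρ ^ 2 * ‖X₀‖ ^ 2) / r := by ring

/-- **CAUCHY BOUND ON THE ACCELERATION**: `‖Γ″ t‖ ≤ b·2·(4C₂ρ²‖X₀‖²) ∕ r²` for `|t| ≤ 1` (complete `𝒳`). [folklore] -/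
theorem norm_chartPath_deriv_deriv_le [CompleteSpace 𝒳] {Xs : ℂ → 𝒳} {X₀ : 𝒴} {C₂ ρ r b : ℝ} (hC₂ : 0 ≤ C₂)
    (hb : 0 ≤ b) (hXd : DifferentiableOn ℂ Xs (ball (0 : ℂ) ρ))
    (hXs : ∀ σ ∈ ball (0 : ℂ) ρ, ‖Xs σ‖ ≤ 4 * C₂ * ‖σ • X₀‖ ^ 2)
    {Hop : 𝒳 →ₗ[ℂ] 𝒴} (hHop : ∀ X, ‖Hop X‖ ≤ b * ‖X‖) (hr : 0 < r) (hρ : 1 + r < ρ) {t : ℝ} (ht : |t| ≤ 1) :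
    ‖-Hop (deriv (deriv Xs) (t : ℂ))‖ ≤ b * (2 * (4 * C₂ * ρ ^ 2 * ‖X₀‖ ^ 2) / r ^ 2) := by
  have hsub : closedBall (t : ℂ) r ⊆ ball (0 : ℂ) ρ := closedBall_ofReal_subset_ball ht hρ
  have hM : ∀ z ∈ closedBall (t : ℂ) r, ‖Xs z‖ ≤ 4 * C₂ * ρ ^ 2 * ‖X₀‖ ^ 2 :=
    fun z hz => norm_le_of_quadBound hC₂ hXs (hsub hz)
  have hd := norm_deriv_deriv_le_of_closedBall hXd hr hsub hM
  rw [norm_neg]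
  exact (hHop _).trans (mul_le_mul_of_nonneg_left hd hb)

/-- The chart path is `C^n` (every `n`) on the open real interval `(−ρ, ρ)` (complete `𝒳`): usable with
`NE3EnergyPathC2Velocity.exists_velocities_of_contDiff`-type consumers after a restriction. [folklore] -/
theorem contDiffOn_chartPath [CompleteSpace 𝒳] {Xs : ℂ → 𝒳} {ρ b : ℝ}
    (hXd : DifferentiableOn ℂ Xs (ball (0 : ℂ) ρ)) {Hop : 𝒳 →ₗ[ℂ] 𝒴} (hHop : ∀ X, ‖Hop X‖ ≤ b * ‖X‖) (X₀ : 𝒴)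
    (n : WithTop ℕ∞) :
    ContDiffOn ℝ n (fun s : ℝ => (s : ℂ) • X₀ - Hop (Xs (s : ℂ))) (Ioo (-ρ) ρ) := by
  have hset : Ioo (-ρ) ρ ⊆ {s : ℝ | (s : ℂ) ∈ ball (0 : ℂ) ρ} := by
    intro s hs
    simp only [mem_setOf_eq, mem_ball_zero_iff, Complex.norm_real, Real.norm_eq_abs]
    exact abs_lt.mpr ⟨by linarith [hs.1], hs.2⟩
  have h1 : ContDiffOn ℝ n (fun s : ℝ => (s : ℂ) • X₀) (Ioo (-ρ) ρ) :=
    (Complex.ofRealCLM.contDiff.smul contDiff_const).contDiffOn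
  have h2 : ContDiffOn ℝ n (fun s : ℝ => Xs (s : ℂ)) (Ioo (-ρ) ρ) :=
    (contDiffOn_ofReal isOpen_ball hXd n).mono hset
  have h3 : ContDiffOn ℝ n (fun s : ℝ => Hop (Xs (s : ℂ))) (Ioo (-ρ) ρ) := by
    have h := ((Hop.mkContinuous b hHop).restrictScalars ℝ).contDiff.comp_contDiffOn h2
    simpa [Function.comp_def] using h
  exact h1.sub h3

end ChartPath

/-! ## §3 The reversed orientation of `RouteLeaves` and the package -/

section Package

variable {𝒳 𝒴 : Type*} [NormedAddCommGroup 𝒳] [NormedSpace ℂ 𝒳] [NormedAddCommGroup 𝒴] [NormedSpace ℂ 𝒴]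

/-- `t ∈ [0,1]` ⟹ `|t| ≤ 1` and `|1 − t| ≤ 1`. [folklore] -/
theorem abs_le_one_of_mem_Icc {t : ℝ} (ht : t ∈ Icc (0 : ℝ) 1) : |t| ≤ 1 ∧ |1 - t| ≤ 1 :=
  ⟨abs_le.mpr ⟨by linarith [ht.1], ht.2⟩, abs_le.mpr ⟨by linarith [ht.2], by linarith [ht.1]⟩⟩

/-- **THE CHART-PATH KINEMATICS, PACKAGED** (input = the output of `NE3Linearising.exists_linearising_path` on a disc of
radius `ρ > 1 + r`): with `Γ t := t • X₀ − Hop (Xs t)`, `Γ′ t := X₀ − Hop (deriv Xs t)`, `Γ″ t := −Hop (deriv (deriv Xs) t)`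
and `M := 4C₂ρ²‖X₀‖²`: `Γ 0 = 0` and, for every `t ∈ [0,1]`, `HasDerivAt Γ (Γ′ t) t`, `HasDerivAt Γ′ (Γ″ t) t`,
`‖Γ t − t • X₀‖ ≤ 4bC₂t²‖X₀‖²`, `‖Γ′ t − X₀‖ ≤ bM ∕ r`, `‖Γ″ t‖ ≤ 2bM ∕ r²`.  NE3 is NOT proved: this is the real-analytic
kinematics of one abstract chart segment. [folklore] -/
theorem chartPath_kinematics [CompleteSpace 𝒳] {Xs : ℂ → 𝒳} {X₀ : 𝒴} {C₂ ρ r b : ℝ} (hC₂ : 0 ≤ C₂) (hb : 0 ≤ b)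
    (hXd : DifferentiableOn ℂ Xs (ball (0 : ℂ) ρ))
    (hXs : ∀ σ ∈ ball (0 : ℂ) ρ, ‖Xs σ‖ ≤ 4 * C₂ * ‖σ • X₀‖ ^ 2)
    {Hop : 𝒳 →ₗ[ℂ] 𝒴} (hHop : ∀ X, ‖Hop X‖ ≤ b * ‖X‖) (hr : 0 < r) (hρ : 1 + r < ρ) :
    ((0 : ℝ) : ℂ) • X₀ - Hop (Xs ((0 : ℝ) : ℂ)) = 0 ∧
    ∀ t ∈ Icc (0 : ℝ) 1,
      HasDerivAt (fun s : ℝ => (s : ℂ) • X₀ - Hop (Xs (s : ℂ))) (X₀ - Hop (deriv Xs (t : ℂ))) t ∧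
      HasDerivAt (fun s : ℝ => X₀ - Hop (deriv Xs (s : ℂ))) (-Hop (deriv (deriv Xs) (t : ℂ))) t ∧
      ‖((t : ℂ) • X₀ - Hop (Xs (t : ℂ))) - (t : ℂ) • X₀‖ ≤ b * (4 * C₂ * t ^ 2 * ‖X₀‖ ^ 2) ∧
      ‖(X₀ - Hop (deriv Xs (t : ℂ))) - X₀‖ ≤ b * (4 * C₂ * ρ ^ 2 * ‖X₀‖ ^ 2) / r ∧
      ‖-Hop (deriv (deriv Xs) (t : ℂ))‖ ≤ b * (2 * (4 * C₂ * ρ ^ 2 * ‖X₀‖ ^ 2) / r ^ 2) := by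
  have hρ0 : 0 < ρ := by linarith
  refine ⟨chartPath_zero hρ0 Hop hXs, fun t ht => ?_⟩
  have ht1 : |t| ≤ 1 := (abs_le_one_of_mem_Icc ht).1
  have htρ : |t| < ρ := by linarith
  exact ⟨hasDerivAt_chartPath hXd hHop X₀ hr hρ ht1, hasDerivAt_chartPath_deriv hXd hHop X₀ hr hρ ht1,
    norm_chartPath_sub_smul_le hHop hb hXs htρ, norm_chartPath_deriv_sub_le hC₂ hb hXd hXs hHop hr hρ ht1,
    norm_chartPath_deriv_deriv_le hC₂ hb hXd hXs hHop hr hρ ht1⟩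

/-- **THE REVERSED ORIENTATION** `Γ_R t := Γ (1 − t)` — the one of `NE3EnergyAssembly.RouteLeaves` (path from the
chart point at `t = 0` to the background at `t = 1`): `Γ_R 1 = 0` (`endW`), and for `t ∈ [0,1]`
`HasDerivAt Γ_R (−Γ′(1−t)) t`, `HasDerivAt (s ↦ −Γ′(1−s)) (Γ″(1−t)) t`, with the same displayed bounds
`‖−Γ′(1−t) − (−X₀)‖ ≤ bM ∕ r` and `‖Γ″(1−t)‖ ≤ 2bM ∕ r²` (`M = 4C₂ρ²‖X₀‖²`). [folklore] -/
theorem chartPath_reversed_kinematics [CompleteSpace 𝒳] {Xs : ℂ → 𝒳} {X₀ : 𝒴} {C₂ ρ r b : ℝ} (hC₂ : 0 ≤ C₂)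
    (hb : 0 ≤ b) (hXd : DifferentiableOn ℂ Xs (ball (0 : ℂ) ρ))
    (hXs : ∀ σ ∈ ball (0 : ℂ) ρ, ‖Xs σ‖ ≤ 4 * C₂ * ‖σ • X₀‖ ^ 2)
    {Hop : 𝒳 →ₗ[ℂ] 𝒴} (hHop : ∀ X, ‖Hop X‖ ≤ b * ‖X‖) (hr : 0 < r) (hρ : 1 + r < ρ) :
    (((1 - (1 : ℝ) : ℝ) : ℂ) • X₀ - Hop (Xs (((1 - (1 : ℝ) : ℝ) : ℂ)))) = 0 ∧
    ∀ t ∈ Icc (0 : ℝ) 1,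
      HasDerivAt (fun s : ℝ => (((1 - s : ℝ)) : ℂ) • X₀ - Hop (Xs ((1 - s : ℝ) : ℂ)))
        (-(X₀ - Hop (deriv Xs ((1 - t : ℝ) : ℂ)))) t ∧
      HasDerivAt (fun s : ℝ => -(X₀ - Hop (deriv Xs ((1 - s : ℝ) : ℂ))))
        (-Hop (deriv (deriv Xs) ((1 - t : ℝ) : ℂ))) t ∧
      ‖-(X₀ - Hop (deriv Xs ((1 - t : ℝ) : ℂ))) - (-X₀)‖ ≤ b * (4 * C₂ * ρ ^ 2 * ‖X₀‖ ^ 2) / r ∧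
      ‖-Hop (deriv (deriv Xs) ((1 - t : ℝ) : ℂ))‖ ≤ b * (2 * (4 * C₂ * ρ ^ 2 * ‖X₀‖ ^ 2) / r ^ 2) := by
  have hρ0 : 0 < ρ := by linarith
  refine ⟨by simpa using chartPath_zero hρ0 Hop hXs, fun t ht => ?_⟩
  have ht1 : |1 - t| ≤ 1 := (abs_le_one_of_mem_Icc ht).2
  have hΓ := hasDerivAt_chartPath hXd hHop X₀ hr hρ ht1
  have hΓ' := hasDerivAt_chartPath_deriv hXd hHop X₀ hr hρ ht1
  refine ⟨?_, ?_, ?_, norm_chartPath_deriv_deriv_le hC₂ hb hXd hXs hHop hr hρ ht1⟩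
  · exact HasDerivAt.comp_const_sub (f := fun s : ℝ => (s : ℂ) • X₀ - Hop (Xs (s : ℂ))) 1 t hΓ
  · have h := HasDerivAt.comp_const_sub (f := fun s : ℝ => X₀ - Hop (deriv Xs (s : ℂ))) 1 t hΓ'
    have h' : HasDerivAt (fun s : ℝ => -(X₀ - Hop (deriv Xs ((1 - s : ℝ) : ℂ))))
        (-(-(-Hop (deriv (deriv Xs) ((1 - t : ℝ) : ℂ))))) t := h.neg
    exact h'.congr_deriv (by rw [neg_neg])
  · rw [show -(X₀ - Hop (deriv Xs ((1 - t : ℝ) : ℂ))) - -X₀ = -((X₀ - Hop (deriv Xs ((1 - t : ℝ) : ℂ))) - X₀) by abel,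
      norm_neg]
    exact norm_chartPath_deriv_sub_le hC₂ hb hXd hXs hHop hr hρ ht1

/-- **E3 + THIS FILE IN ONE CALL**: under EXACTLY the hypotheses of `NE3Linearising.exists_linearising_path` and a margin
`1 + r < ρ`, the holomorphic fixed point `Xs` exists with E3's conclusions (ball membership, fixed-point equation, quadratic
bound, the LINEARISATION `N (σ • X₀ − Hop (Xs σ)) = σ • Q X₀`) AND the chart path built from it has the kinematics of
`chartPath_kinematics` on `[0,1]`.  For a tangent datum (`Q X₀ = 0`) the whole real path lies in the fibre `N = 0`
(`NE3Linearising.path_in_fibre`).  NE3 is NOT proved. [folklore] -/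
theorem exists_chartPath_kinematics [CompleteSpace 𝒳] {N C : 𝒴 → 𝒳} {Q : 𝒴 →ₗ[ℂ] 𝒳} {Hop : 𝒳 →ₗ[ℂ] 𝒴}
    {C₂ R b ε ρ r : ℝ} (hC : QuadAnalytic C C₂ R) (hC₂ : 0 ≤ C₂) (hb : 0 ≤ b) (hHop : ∀ X, ‖Hop X‖ ≤ b * ‖X‖)
    (hN : ∀ A, N A = Q A + C A) (hQH : ∀ X, Q (Hop X) = X) (hq : 9 * C₂ * b * ε < 1) (hRC : 3 * ε ≤ R)
    (X₀ : 𝒴) (hρX : ρ * ‖X₀‖ < ε) (hr : 0 < r) (hρ : 1 + r < ρ)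
    (hC' : ∀ g : ℂ → 𝒳, DifferentiableOn ℂ g (ball (0:ℂ) ρ) →
      MapsTo g (ball (0:ℂ) ρ) (closedBall (0:𝒳) (4 * C₂ * ε ^ 2)) →
        DifferentiableOn ℂ (fun σ => C (σ • X₀ - Hop (g σ))) (ball (0:ℂ) ρ)) :
    ∃ Xs : ℂ → 𝒳, DifferentiableOn ℂ Xs (ball (0:ℂ) ρ) ∧
      (∀ σ ∈ ball (0:ℂ) ρ, Xs σ ∈ closedBall (0:𝒳) (4 * C₂ * ε ^ 2) ∧ C (σ • X₀ - Hop (Xs σ)) = Xs σ ∧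
        ‖Xs σ‖ ≤ 4 * C₂ * ‖σ • X₀‖ ^ 2 ∧ N (σ • X₀ - Hop (Xs σ)) = σ • Q X₀) ∧
      ((0 : ℝ) : ℂ) • X₀ - Hop (Xs ((0 : ℝ) : ℂ)) = 0 ∧
      ∀ t ∈ Icc (0 : ℝ) 1,
        HasDerivAt (fun s : ℝ => (s : ℂ) • X₀ - Hop (Xs (s : ℂ))) (X₀ - Hop (deriv Xs (t : ℂ))) t ∧
        HasDerivAt (fun s : ℝ => X₀ - Hop (deriv Xs (s : ℂ))) (-Hop (deriv (deriv Xs) (t : ℂ))) t ∧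
        ‖((t : ℂ) • X₀ - Hop (Xs (t : ℂ))) - (t : ℂ) • X₀‖ ≤ b * (4 * C₂ * t ^ 2 * ‖X₀‖ ^ 2) ∧
        ‖(X₀ - Hop (deriv Xs (t : ℂ))) - X₀‖ ≤ b * (4 * C₂ * ρ ^ 2 * ‖X₀‖ ^ 2) / r ∧
        ‖-Hop (deriv (deriv Xs) (t : ℂ))‖ ≤ b * (2 * (4 * C₂ * ρ ^ 2 * ‖X₀‖ ^ 2) / r ^ 2) := by
  obtain ⟨Xs, hXd, hXs⟩ := exists_linearising_path hC hC₂ hb hHop hN hQH hq hRC X₀ hρX hC'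
  have hq' : ∀ σ ∈ ball (0:ℂ) ρ, ‖Xs σ‖ ≤ 4 * C₂ * ‖σ • X₀‖ ^ 2 := fun σ hσ => (hXs σ hσ).2.2.1
  obtain ⟨h0, hkin⟩ := chartPath_kinematics hC₂ hb hXd hq' hHop hr hρ
  exact ⟨Xs, hXd, hXs, h0, hkin⟩

end Package

end

end Summit.QuantumFields.BalabanUV.T4Continuum.NE3LinearisingPath
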